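import Summits.Ventures.DiscreteObjects.Hadamard.ConferenceGraph333EvenAutomorphisms

/-!
# The orbit bound: an automorphism of srg(333,166,82,83) with an orbit of length `L ≥ 2` fixes at most `333/L − 1` points (kernel)

Framing: lottery ticket; floor = certified bounds/negative ranges.  Cell pub-namedobj (venture DiscreteObjects),
target (H) = `H(668)`, hadamard gen 29.  A one-line strengthening of the fixed-point windows of the automorphism census of
`srg(333,166,82,83)` ⇔ symmetric `C(334)` (⇒ `H(668)`), valid for EVERY automorphism `σ` (no arithmetic condition on the
order): let `O` be a `⟨σ⟩`-orbit of length `L ≥ 2` and `u` its indicator vector.  For the Seidel matrix `S` (`S² = 333 I − J`),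
`‖S u‖² = uᵀ(333 I − J)u = 333 L − L²`, while for every FIXED vertex `y` the entry `(S u)_y = Σ_{x ∈ O} S_{yx} = L·S_{y x₀} = ±L`
(`S_{y,σ^k x₀} = S_{σ^k y, σ^k x₀} = S_{y x₀}`).  Hence `f·L² ≤ 333 L − L²`:
* **`aut_orbit_length_bound`** — `L · (#Fix σ + 1) ≤ 333` for the minimal period `L ≥ 2` of any vertex;
* **`aut_prime_pow_order_bound`** — if `σ^(p^(e+1)) = 1 ≠ σ^(p^e)` (`p` prime) some vertex has period `p^(e+1)`, so
  `p^(e+1) · (#Fix σ + 1) ≤ 333`; **`aut_two_power_windows`**: order `4 ⇒ f ≤ 82`, `8 ⇒ f ≤ 40`, `16 ⇒ f ≤ 19`, `32 ⇒ f ≤ 9`,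
  `64 ⇒ f ≤ 4`, `128 ⇒ f ≤ 1` (and `2^(e+1) ≤ 333`); **`aut_period_gt_166`** — a vertex of period `> 166` forces `f = 0`.
(For `L = 2` this is the involution bound `f ≤ 165` of `ConferenceGraph333InvolutionBound`; for odd prime `L = p` it is weaker than
gen 28's row bound, which also counts the other orbits.)  Script consequence (code/order_census_g29.py with the bound applied to every
power): 23 further element orders die (49, 69, 92, 98, 100, 110, 112, 117, 126, 128, 135, …, 165).  Structure of a HYPOTHETICAL object;
ours (PROVISIONAL).  No `sorry`, no new definitions.
-/

namespace Summit.Ventures.DiscreteObjects.Hadamard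

open Finset

section orbitbound
variable {V : Type*} [Fintype V] [DecidableEq V]

/-- **Orbit bound.**  If a vertex `x₀` has minimal period `L ≥ 2` under an adjacency-preserving permutation `σ` of an
`srg(333,166,82,83)`, then `L · (#Fix σ + 1) ≤ 333`. -/
theorem aut_orbit_length_bound (hV : Fintype.card V = 333) (A : Matrix V V ℤ)
    (h01 : ∀ x y, A x y = 0 ∨ A x y = 1) (hsymm : ∀ x y, A y x = A x y) (hdiag : ∀ x, A x x = 0)
    (hk : ∀ x, ∑ y, A x y = 166) (hsrg : ∀ x y, ∑ z, A x z * A z y = 83 * (1 + (if x = y then 1 else 0)) - A x y)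
    (σ : Equiv.Perm V) (hA : ∀ x y, A (σ x) (σ y) = A x y) (x₀ : V) (hL : 2 ≤ Function.minimalPeriod σ x₀) :
    Function.minimalPeriod σ x₀ * ((univ.filter fun y => σ y = y).card + 1) ≤ 333 := by
  obtain ⟨hSd, hSo, hSs, -, hSS⟩ := seidel_identities_of_conferenceGraph A h01 hsymm hdiag 83
    (by rw [hV]; norm_num) (fun x => by rw [hk x]; norm_num) hsrg
  set S : V → V → ℤ := fun x y => 1 - (if x = y then 1 else 0) - 2 * A x y with hS_def
  have hSS' : ∀ x y, ∑ z, S x z * S z y = 333 * (if x = y then 1 else 0) - 1 := fun x y => by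
    rw [hSS x y, hV]; norm_num
  have hSσ : ∀ x y, S (σ x) (σ y) = S x y := fun x y => by
    simp only [hS_def, hA, σ.injective.eq_iff]
  have hSσk : ∀ (k : ℕ) x y, S ((σ ^ k) x) ((σ ^ k) y) = S x y := by
    intro k; induction k with
    | zero => intro x y; simp
    | succ k ih => intro x y; rw [pow_succ', Equiv.Perm.mul_apply, Equiv.Perm.mul_apply, hSσ, ih]
  have hSs' : ∀ x y, S y x = S x y := fun x y => hSs x y
  have hSo' : ∀ x y, x ≠ y → S x y = 1 ∨ S x y = -1 := fun x y => hSo x y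
  have hcol : ∀ a b, ∑ y, S y a * S y b = 333 * (if a = b then 1 else 0) - 1 := by
    intro a b
    rw [Finset.sum_congr rfl fun y _ => by rw [hSs' a y]]
    exact hSS' a b
  -- the orbit
  set L : ℕ := Function.minimalPeriod σ x₀ with hL_def
  set O : Finset V := (Finset.range L).image (fun k => (σ ^ k) x₀) with hO_def
  have hinj : Set.InjOn (fun k => (σ ^ k) x₀) (Finset.range L : Set ℕ) := perm_pow_injOn_range σ x₀
  have hOcard : O.card = L := by rw [hO_def, Finset.card_image_of_injOn hinj, Finset.card_range]
  have hx₀ : σ x₀ ≠ x₀ := by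
    intro h
    have : Function.minimalPeriod σ x₀ = 1 := Function.minimalPeriod_eq_one_iff_isFixedPt.mpr h
    omega
  -- g y = Σ_{x ∈ O} S y x and Σ_y g(y)² = 333 L − L²
  set g : V → ℤ := fun y => ∑ x ∈ O, S y x with hg_def
  have hg2 : ∑ y, g y ^ 2 = 333 * L - L * L := by
    have e : ∀ y, g y ^ 2 = ∑ x ∈ O, ∑ x' ∈ O, S y x * S y x' := by
      intro y; rw [hg_def, sq, Finset.sum_mul_sum]
    rw [Finset.sum_congr rfl fun y _ => e y, Finset.sum_comm]
    rw [Finset.sum_congr rfl fun x _ => Finset.sum_comm]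
    simp_rw [hcol]
    have e2 : ∀ x ∈ O, ∑ x' ∈ O, ((333 : ℤ) * (if x = x' then 1 else 0) - 1) = 333 - L := by
      intro x hx
      rw [Finset.sum_sub_distrib, Finset.sum_const, ← Finset.mul_sum, Finset.sum_ite_eq, if_pos hx, hOcard]
      simp
    rw [Finset.sum_congr rfl e2, Finset.sum_const, hOcard, nsmul_eq_mul]
    ring
  -- fixed vertices: g y = L · S y x₀ = ± L
  have hfix : ∀ y, σ y = y → g y ^ 2 = (L : ℤ) * L := by
    intro y hy
    have hyk : ∀ k : ℕ, (σ ^ k) y = y := fun k => Equiv.Perm.pow_apply_eq_self_of_apply_eq_self hy k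
    have e : g y = ∑ k ∈ Finset.range L, S y x₀ := by
      show ∑ x ∈ O, S y x = _
      rw [hO_def, Finset.sum_image (fun a ha b hb h => hinj ha hb h)]
      refine Finset.sum_congr rfl fun k _ => ?_
      rw [← hSσk k y x₀, hyk k]
    rw [e, Finset.sum_const, Finset.card_range, nsmul_eq_mul]
    have hyx : y ≠ x₀ := fun h => hx₀ (h ▸ hy)
    rcases hSo' y x₀ hyx with h | h <;> rw [h] <;> ring
  -- compare
  have hsplit := Finset.sum_filter_add_sum_filter_not (univ : Finset V) (fun y => σ y = y) (fun y => g y ^ 2)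
  rw [hg2] at hsplit
  have hF : ∑ y ∈ univ.filter (fun y => σ y = y), g y ^ 2 = ((univ.filter fun y => σ y = y).card : ℤ) * (L * L) := by
    rw [Finset.sum_congr rfl fun y hy => hfix y (Finset.mem_filter.mp hy).2, Finset.sum_const, nsmul_eq_mul]
  have hM : 0 ≤ ∑ y ∈ univ.filter (fun y => ¬ σ y = y), g y ^ 2 := Finset.sum_nonneg fun y _ => sq_nonneg _
  set f : ℕ := (univ.filter fun y => σ y = y).card with hf_def
  have hineq : (f : ℤ) * (L * L) + L * L ≤ 333 * L := by linarith
  have hLpos : (0 : ℤ) < L := by exact_mod_cast (show 0 < L by omega)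
  have h2 : (L : ℤ) * (f + 1) ≤ 333 := by nlinarith
  exact_mod_cast h2

/-- **Prime-power orders.**  If `σ^(p^(e+1)) = 1` but `σ^(p^e) ≠ 1` (`p` prime), some vertex has period exactly `p^(e+1)`, so
`p^(e+1) · (#Fix σ + 1) ≤ 333`. -/
theorem aut_prime_pow_order_bound (hV : Fintype.card V = 333) (A : Matrix V V ℤ)
    (h01 : ∀ x y, A x y = 0 ∨ A x y = 1) (hsymm : ∀ x y, A y x = A x y) (hdiag : ∀ x, A x x = 0)
    (hk : ∀ x, ∑ y, A x y = 166) (hsrg : ∀ x y, ∑ z, A x z * A z y = 83 * (1 + (if x = y then 1 else 0)) - A x y)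
    (σ : Equiv.Perm V) (hA : ∀ x y, A (σ x) (σ y) = A x y) {p : ℕ} (hp : p.Prime) (e : ℕ)
    (hσ : σ ^ (p ^ (e + 1)) = 1) (hne : σ ^ (p ^ e) ≠ 1) :
    p ^ (e + 1) * ((univ.filter fun y => σ y = y).card + 1) ≤ 333 := by
  obtain ⟨x₀, hx₀⟩ : ∃ x, (σ ^ (p ^ e)) x ≠ x := by
    by_contra hc
    exact hne (Equiv.ext fun y => by by_contra hy; exact hc ⟨y, hy⟩)
  have hdvd : Function.minimalPeriod σ x₀ ∣ p ^ (e + 1) := by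
    refine Function.IsPeriodicPt.minimalPeriod_dvd ?_
    show (σ : V → V)^[p ^ (e + 1)] x₀ = x₀
    rw [Equiv.Perm.iterate_eq_pow, hσ, Equiv.Perm.one_apply]
  obtain ⟨i, hi, hi'⟩ := (Nat.dvd_prime_pow hp).mp hdvd
  have hnot : ¬ Function.minimalPeriod σ x₀ ∣ p ^ e := by
    intro h
    apply hx₀
    have := Function.isPeriodicPt_iff_minimalPeriod_dvd.mpr h
    rw [Function.IsPeriodicPt, Function.IsFixedPt, Equiv.Perm.iterate_eq_pow] at this
    exact this
  have hie : i = e + 1 := by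
    by_contra hne'
    have hle : i ≤ e := by omega
    exact hnot (hi' ▸ pow_dvd_pow p hle)
  rw [hie] at hi'
  have h2 : 2 ≤ Function.minimalPeriod σ x₀ := by
    rw [hi']
    calc 2 ≤ p := hp.two_le
      _ = p ^ 1 := (pow_one p).symm
      _ ≤ p ^ (e + 1) := Nat.pow_le_pow_right hp.pos (by omega)
  have := aut_orbit_length_bound hV A h01 hsymm hdiag hk hsrg σ hA x₀ h2
  rwa [hi'] at this

/-- **Windows for 2-power orders.**  `σ⁴ = 1 ≠ σ²`: `f ≤ 82` · `σ⁸ = 1 ≠ σ⁴`: `f ≤ 40` · `16`: `f ≤ 19` · `32`: `f ≤ 9` · `64`: `f ≤ 4` ·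
`128`: `f ≤ 1`, for `f = #Fix σ`. -/
theorem aut_two_power_windows (hV : Fintype.card V = 333) (A : Matrix V V ℤ)
    (h01 : ∀ x y, A x y = 0 ∨ A x y = 1) (hsymm : ∀ x y, A y x = A x y) (hdiag : ∀ x, A x x = 0)
    (hk : ∀ x, ∑ y, A x y = 166) (hsrg : ∀ x y, ∑ z, A x z * A z y = 83 * (1 + (if x = y then 1 else 0)) - A x y)
    (σ : Equiv.Perm V) (hA : ∀ x y, A (σ x) (σ y) = A x y) (e : ℕ) (hσ : σ ^ (2 ^ (e + 1)) = 1)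
    (hne : σ ^ (2 ^ e) ≠ 1) :
    let f := (univ.filter fun y => σ y = y).card
    (e = 1 → f ≤ 82) ∧ (e = 2 → f ≤ 40) ∧ (e = 3 → f ≤ 19) ∧ (e = 4 → f ≤ 9) ∧ (e = 5 → f ≤ 4) ∧ (e = 6 → f ≤ 1) ∧
      e ≤ 7 := by
  intro f
  have h := aut_prime_pow_order_bound hV A h01 hsymm hdiag hk hsrg σ hA Nat.prime_two e hσ hne
  have he : e ≤ 7 := by
    by_contra hc
    have : 2 ^ 9 ≤ 2 ^ (e + 1) := Nat.pow_le_pow_right (by norm_num) (by omega)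
    have : 2 ^ (e + 1) ≤ 333 := le_trans (Nat.le_mul_of_pos_right _ (by omega)) h
    omega
  refine ⟨?_, ?_, ?_, ?_, ?_, ?_, he⟩ <;> intro hev <;> subst hev <;> norm_num at h <;> omega

/-- **Long periods force fixed-point-freeness.**  A vertex of period `L > 166` forces `#Fix σ = 0` (`L·(f+1) ≤ 333`). -/
theorem aut_period_gt_166 (hV : Fintype.card V = 333) (A : Matrix V V ℤ)
    (h01 : ∀ x y, A x y = 0 ∨ A x y = 1) (hsymm : ∀ x y, A y x = A x y) (hdiag : ∀ x, A x x = 0)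
    (hk : ∀ x, ∑ y, A x y = 166) (hsrg : ∀ x y, ∑ z, A x z * A z y = 83 * (1 + (if x = y then 1 else 0)) - A x y)
    (σ : Equiv.Perm V) (hA : ∀ x y, A (σ x) (σ y) = A x y) (x₀ : V) (hL : 166 < Function.minimalPeriod σ x₀) :
    (univ.filter fun y => σ y = y).card = 0 := by
  have h := aut_orbit_length_bound hV A h01 hsymm hdiag hk hsrg σ hA x₀ (by omega)
  by_contra hne
  have : 1 ≤ (univ.filter fun y => σ y = y).card := Nat.one_le_iff_ne_zero.mpr hne
  nlinarith

end orbitbound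

end Summit.Ventures.DiscreteObjects.Hadamard
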